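import Summits.Ventures.QEC.Census.CertCoverBatch
import Summits.Ventures.QEC.Census.BB.A1s_n192_k4_0fa3ae82.CoreDefs
import HarnessLib

set_option Elab.async false
set_option maxRecDepth 200000

/-!
# `[[192,4,18]]` one-level cover certificate — LEVEL-1→0 coset problems 381…390 (problem 1 excluded: `Prob1.lean`) as COMPACT data
(`ProbData`: U, f, σ, y₀, allow; qec-type-10 `CertCoverBatch.mkCoset` rebuilds each `CosetProb` in the kernel) + their verdict
`probsOK cov covR hx hx1 D1 lxd 16` (one `decide +kernel`). qec-search-9 g5 (lead block 170 (0)(c)); data from JSON `level10.problems`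
(sha256 08367568…). Data + decided check; KERNEL.
-/

namespace Summit.Ventures.QEC.Census.A1s_n192_k4_0fa3ae82

open Matrix Summit.Ventures.QEC.Census Literature.InformationTheory.QuantumCodes

/-- Problems 381…390 (10): `⟨U, f, σ, y₀, allow⟩`. -/
def probs07d : List ProbData := [
    ⟨1818125833934645521424640, 0, 0, 0, [0]⟩,
    ⟨1818126700877608150253824, 0, 0, 0, [0]⟩,
    ⟨1818128434763533407912192, 0, 0, 0, [0]⟩,
    ⟨1818129596974126721942404, 0, 1099520278528, 18446744073709551616, [0]⟩,
    ⟨1818129614990730714482697, 0, 2199032233984, 604462910092642151045143, []⟩,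
    ⟨1818129687611266115829769, 1, 2199032233984, 1818111096749805306642441, [0, 256, 36893488147419103232]⟩,
    ⟨1818129832852336918794249, 0, 2199032233984, 1818129832007911955108096, []⟩,
    ⟨1818134154617501520397568, 0, 0, 0, [0]⟩,
    ⟨1818134262422413305577728, 1, 0, 0, [0, 549755813888, 9223372036854775808]⟩,
    ⟨1818134695893860259991808, 0, 0, 0, [0]⟩]

set_option maxHeartbeats 400000000 in
/-- Every problem of this chunk passes (`mkCoset` elimination + `cosetOKD` + fast `σ` + depth + `BU`-evenness + label checks). -/
theorem probs07d_ok : probsOK cov covR hx hx1 D1 lxd 16 probs07d = true := by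
  decide +kernel

/-- Pointwise form. -/
theorem probs07d_all : ∀ x ∈ probs07d, probOK cov covR hx hx1 D1 lxd 16 x = true := by
  have h := probs07d_ok
  rwa [probsOK, List.all_eq_true] at h

end Summit.Ventures.QEC.Census.A1s_n192_k4_0fa3ae82
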